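import Mathlib.MeasureTheory.Integral.Bochner.Basic
import Mathlib.Analysis.Complex.UpperHalfPlane.Basic
import Mathlib.Analysis.SpecialFunctions.Complex.CircleAddChar
import Mathlib.NumberTheory.GaussSum
import Mathlib.Algebra.Module.ZLattice.Basic
import Mathlib.NumberTheory.ModularForms.CongruenceSubgroups
import Literature.NumberTheory.EllipticCurves.Newforms
import Literature.NumberTheory.EllipticCurves.CuspFormLFunction
import HarnessLib

-- D-0014 sorry-sweep (operator, 2026-08-13): sorried theorems -> named facts `def X : Prop`; partial proofs preserved in comments
-- provenance: harness21/H21/H21/Prelude/EllArithM/ModularSymbols.lean @ 96a2136 (interim HEAD d8f2665); M5 mechanical rewrite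
/-!
# Modular symbols and periods of weight-`2` cusp forms (trunk EllArithM, item C9)

For a cusp form `f ∈ S_2(Γ₀(N))` we define

* `modularSymbol f r = {∞, r}_f = 2πi ∫_{i∞}^{r} f(z) dz` for a rational cusp `r`, realised as
  the absolutely convergent real integral `2π ∫₀^∞ f(r + it) dt` along the vertical geodesic from
  `i∞` to `r` (orientation: with `z = r + it`, `dz = i dt` and `t` runs from `∞` down to `0`, so
  `2πi ∫_{i∞}^r f dz = 2πi ∫_∞^0 f(r + it) i dt = -2π ∫_∞^0 f(r + it) dt = 2π ∫₀^∞ f(r + it) dt`;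
  in particular
  `{∞, 0}_f = 2π ∫₀^∞ f(it) dt = ∑ aₙ/n = L(f, 1)`);
* `eichlerIntegral f τ = 2πi ∫_{i∞}^{τ} f(z) dz` for `τ ∈ ℍ` (same vertical-ray integral);
* `plusSymbol f r = ({∞, r} + {∞, -r}) / 2`, `minusSymbol f r = ({∞, r} - {∞, -r}) / 2`
  (the `1/2` is the recorded convention, OUTLINE §4.6; for `f` with real coefficients
  `{∞, -r} = conj {∞, r}`, so these are `re {∞, r}` and `i · im {∞, r}`);
* `cuspSymbol f γ = {∞, γ∞}_f` for `γ = (a b; c d) ∈ Γ₀(N)` (`γ∞ = a/c`; `0` if `c = 0`), the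
  period of `f` over the *closed* path `∞ → γ∞` on `X₀(N)`;
* `periodLattice f = Λ_f`, the subgroup of `ℂ` generated by the `{∞, γ∞}_f`, `γ ∈ Γ₀(N)`. By
  Manin (1972, Prop. 1.4 / Thm. 1.9) `Γ₀(N) → H₁(X₀(N), ℤ)`, `γ ↦ {τ, γτ}` is onto, so `Λ_f` is
  the lattice of periods of `2πi f(z) dz` over integral cycles. General symbols `{∞, r}` only
  lie in `ℚ ⊗ Λ_f` (Manin–Drinfeld), which is why the lattice is generated by closed paths only;
* `realPeriods f = re Λ_f`, `imagPeriods f = im Λ_f`, and the real/imaginary periods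
  `plusPeriod f = Ω⁺_f`, `minusPeriod f = Ω⁻_f`, normalised by `re Λ_f = ℤ · Ω⁺/2`,
  `im Λ_f = ℤ · Ω⁻/2`, `Ω^± > 0` (junk `0` if `re Λ_f`, resp. `im Λ_f`, is not infinite cyclic).
  The `/2`: for a lattice `Λ ⊂ ℂ` stable under complex conjugation with `Λ ∩ ℝ = ℤΩ₀`, `re Λ` is
  `ℤΩ₀` if `Λ` is rectangular and `ℤ(Ω₀/2)` if `Λ` is rhombic, since `2 re z = z + z̄ ∈ Λ ∩ ℝ`;
  hence `Ω⁺ = 2 · gen(re Λ)` equals `Ω₀ · #(components of E_Λ(ℝ)) = ∫_{E_Λ(ℝ)} |dz|`, the real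
  period *including* the number of real components, matching item G06 `realPeriod`;
* `normalizedPlusSymbol f r = [r]⁺ = re (plusSymbol f r) / Ω⁺` and
  `normalizedMinusSymbol f r = [r]⁻ = im (minusSymbol f r) / Ω⁻`
  (Mazur–Tate–Teitelbaum §I.8; `[0]⁺ = L(f, 1)/Ω⁺`);
* `twistedSymbolSum f χ = ∑_{a mod m} χ(a) {∞, a/m}_f`, the right-hand side of Birch's formula
  `τ(χ⁻¹) L(f, χ, 1) = ∑_{a mod m} χ⁻¹(a) {∞, a/m}_f` for primitive `χ`.

Theorems (proofs `sorry`): integrability of the integrand, `{∞, 0} = L(f, 1)` (through an entire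
continuation of `L(f, s)`: `s = 1` is outside the half-plane `re s > 2` of absolute convergence,
so `cuspFormLSeries f 1` is never written), Manin's homomorphism property of `γ ↦ {∞, γ∞}`,
`Γ₀(N)`-behaviour of the Eichler integral and of `{∞, r}` (Manin relations),
the Manin–Drinfeld theorem and the Eichler–Shimura lattice property for rational newforms, and
Birch's formula for twisted `L`-values.

Proved (last section): the lattice-theoretic step of `Ω^±_f > 0` — a discrete, conjugation-stable
subgroup `L ⊆ ℂ` spanning `ℂ` over `ℝ` has `re L = ℤ(Ω⁺/2)`, `im L = ℤ(Ω⁻/2)` with `Ω^± > 0`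
(Cremona §2.8: "`Ω(f)` is twice the least real part of a period of `f`") — and hence the
reductions `IsNewform0.plusPeriod_pos_of`, `IsNewform0.minusPeriod_pos_of` of the named facts
`IsNewform0.plusPeriod_pos`, `IsNewform0.minusPeriod_pos` to the named facts
`isZLattice_periodLattice` (Eichler–Shimura) and `conj_mem_periodLattice`.

## Design notes

* Everything is in `namespace Literature.ModularForms` (OUTLINE, review 9b).
* Mathlib has no modular symbols, Eichler integrals or period lattices of modular forms
  (searched `modularSymbol`, `Eichler`, `periodLattice`, `Manin`); it has
  `UpperHalfPlane.ofComplex` (junk-extended inverse of `ℍ → ℂ`, harmless here since `t > 0`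
  in the integrand a.e.), the Bochner integral, `AddSubgroup.closure/zmultiples`, `IsZLattice`,
  `gaussSum` and `ZMod.stdAddChar` (`j ↦ e^{2πij/N}`), all used rather than redefined.
* `Γ₀(N)` is Mathlib's `CongruenceSubgroup.Gamma0 N : Subgroup SL(2, ℤ)`; it acts on `ℍ` through
  `SL(2, ℤ)` (`UpperHalfPlane.SLAction`).
* Item G06 (`realPeriod` of a Weierstrass curve) is deliberately not imported; the comparison
  `Ω⁺_f = realPeriod E_f` belongs to item C17.

## References

* Ju. I. Manin, *Parabolic points and zeta functions of modular curves*, Izv. Akad. Nauk SSSR 36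
  (1972), 19–66: Prop. 1.4, Thm. 1.3, Thm. 1.6, Thm. 1.9, Cor. 3.6.
* V. G. Drinfeld, *Two theorems on modular curves*, Funct. Anal. Appl. 7 (1973), 155–156.
* B. Mazur, J. Tate, J. Teitelbaum, *On `p`-adic analogues of the conjectures of Birch and
  Swinnerton-Dyer*, Invent. Math. 84 (1986), §I.8, (8.6).
* B. J. Birch, *Elliptic curves over `ℚ`: a progress report*, Proc. Sympos. Pure Math. 20 (1971).
* J. E. Cremona, *Algorithms for modular elliptic curves*, 2nd ed., CUP 1997, §2.1–2.8, §2.10.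
* G. Shimura, *Introduction to the arithmetic theory of automorphic functions*, 1971, Thm. 3.66,
  Thm. 7.14 (Eichler–Shimura).
-/

noncomputable section

open scoped MatrixGroups ModularForm

open CongruenceSubgroup UpperHalfPlane Complex MeasureTheory

namespace Literature.NumberTheory.EllipticCurves.ModularForms

/-! ### Modular symbols and the Eichler integral -/

section Symbols

variable {N : ℕ} (f : CuspForm (Gamma0 N) 2)

/-- The **modular symbol** `{∞, r}_f = 2πi ∫_{i∞}^{r} f(z) dz ∈ ℂ` of a weight-`2` cusp form
`f` on `Γ₀(N)` at a rational cusp `r`, defined as `2π ∫₀^∞ f(r + it) dt` (substitute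
`z = r + it`, `dz = i dt`, `t` from `∞` to `0`: `2πi ∫_{i∞}^r f dz = 2πi ∫_∞^0 f(r+it) i dt
= 2π ∫₀^∞ f(r + it) dt`). The integral converges absolutely
(`integrableOn_modularSymbol_integrand`); `UpperHalfPlane.ofComplex` is Mathlib's junk-extended
inverse of the coercion `ℍ → ℂ`, and `r + it ∈ ℍ` for all `t > 0`. In particular
`{∞, 0}_f = L(f, 1)` (`modularSymbol_zero_eq`) (Manin 1972, §1.2–1.5; Cremona §2.1, §2.8;
Mazur–Tate–Teitelbaum §I.1). [cite: Manin1972, §1.2–1.5] -/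
def modularSymbol (r : ℚ) : ℂ :=
  2 * Real.pi * ∫ t in Set.Ioi (0 : ℝ), f (ofComplex ((r : ℂ) + t * Complex.I))

/-- The **Eichler integral** `2πi ∫_{i∞}^{τ} f(z) dz` of a weight-`2` cusp form at `τ ∈ ℍ`,
defined as `2π ∫₀^∞ f(τ + it) dt` along the vertical ray above `τ` (same orientation computation
as for `modularSymbol`) (Manin 1972, §1.5; Cremona §2.10; Shimura 1971, §7.2). [cite: Manin1972, §1.5] -/
def eichlerIntegral (τ : ℍ) : ℂ :=
  2 * Real.pi * ∫ t in Set.Ioi (0 : ℝ), f (ofComplex ((τ : ℂ) + t * Complex.I))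

/-- The **plus modular symbol** `({∞, r}_f + {∞, -r}_f) / 2`. For `f` with real Fourier
coefficients `{∞, -r} = conj {∞, r}`, so this is `re {∞, r}_f`; the factor `1/2` is the
convention of Mazur–Tate–Teitelbaum §I.8 and Cremona §2.8. [folklore] -/
def plusSymbol (r : ℚ) : ℂ :=
  (modularSymbol f r + modularSymbol f (-r)) / 2

/-- The **minus modular symbol** `({∞, r}_f - {∞, -r}_f) / 2`; for `f` with real Fourier
coefficients this is `i · im {∞, r}_f` (Mazur–Tate–Teitelbaum §I.8; Cremona §2.8). [folklore] -/
def minusSymbol (r : ℚ) : ℂ :=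
  (modularSymbol f r - modularSymbol f (-r)) / 2

/-- The **cusp-to-cusp period** `{∞, γ∞}_f` for `γ = (a b; c d) ∈ Γ₀(N)`: `γ∞ = a/c`, so this is
`{∞, a/c}_f` if `c ≠ 0`, and `0` if `c = 0` (then `γ∞ = ∞`). Since `∞` and `γ∞` have the same
image on `X₀(N)`, this is the integral of `2πi f(z) dz` over a closed path, i.e. a genuine period;
`γ ↦ {∞, γ∞}` is a homomorphism `Γ₀(N) → ℂ` (`cuspSymbol_mul`) which equals `γ ↦ {τ, γτ}` for
any base point `τ` (`eichlerIntegral_smul_sub`) (Manin 1972, Prop. 1.4, Thm. 1.6;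
Cremona §2.1). [cite: Manin1972, Prop. 1.4  Thm. 1.6] -/
def cuspSymbol (γ : Gamma0 N) : ℂ :=
  if (γ : SL(2, ℤ)) 1 0 = 0 then 0
  else modularSymbol f (((γ : SL(2, ℤ)) 0 0 : ℚ) / ((γ : SL(2, ℤ)) 1 0 : ℚ))

/-- The **period lattice** `Λ_f ⊆ ℂ` of `f`: the subgroup generated by the periods
`{∞, γ∞}_f`, `γ ∈ Γ₀(N)`, i.e. (Manin 1972, Prop. 1.4, Thm. 1.9: `γ ↦ {τ, γτ}` maps `Γ₀(N)`
onto `H₁(X₀(N), ℤ)`) the group of periods of `2πi f(z) dz` over integral `1`-cycles on `X₀(N)`.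
For a normalised newform with rational coefficients it is a rank-`2` lattice, the period lattice
of the optimal elliptic curve `E_f = ℂ/Λ_f` (Eichler–Shimura; `isZLattice_periodLattice`);
general symbols `{∞, r}_f` lie only in `ℚ ⊗ Λ_f` (Manin–Drinfeld) (Cremona §2.6–2.8). [cite: Manin1972, Prop. 1.4  Thm. 1.9:  γ ↦ {τ  γτ}  maps] -/
def periodLattice : AddSubgroup ℂ :=
  AddSubgroup.closure (Set.range (cuspSymbol f))

/-- The group `re Λ_f ⊆ ℝ` of real parts of periods of `f` (Cremona §2.8). [folklore] -/
def realPeriods : AddSubgroup ℝ :=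
  (periodLattice f).map Complex.reLm.toAddMonoidHom

/-- The group `im Λ_f ⊆ ℝ` of imaginary parts of periods of `f` (Cremona §2.8). [folklore] -/
def imagPeriods : AddSubgroup ℝ :=
  (periodLattice f).map Complex.imLm.toAddMonoidHom

open Classical in
/-- The **real period** `Ω⁺_f > 0` of `f`: the positive real number with `re Λ_f = ℤ · (Ω⁺_f/2)`,
if `re Λ_f` is infinite cyclic, and the junk value `0` otherwise. For a conjugation-stable lattice
`Λ` with `Λ ∩ ℝ = ℤΩ₀` (`Ω₀ > 0`) one has `re Λ = ℤΩ₀` (rectangular `Λ`, `E_Λ(ℝ)` has two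
components) or `ℤ(Ω₀/2)` (rhombic `Λ`, one component), because `2 re z = z + z̄ ∈ Λ ∩ ℝ`; so
`Ω⁺ = Ω₀ · #π₀(E_Λ(ℝ)) = ∫_{E_Λ(ℝ)} |dz|`, the real period *including* the number of real
components (the BSD normalisation of item G06 `realPeriod`; Cremona §2.8, §3.4;
Mazur–Tate–Teitelbaum §I.8). [folklore] -/
def plusPeriod : ℝ :=
  if h : ∃ Ω : ℝ, 0 < Ω ∧ realPeriods f = AddSubgroup.zmultiples (Ω / 2) then h.choose else 0

open Classical in
/-- The **imaginary period** `Ω⁻_f > 0` of `f`: the positive real number with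
`im Λ_f = ℤ · (Ω⁻_f/2)` if `im Λ_f` is infinite cyclic, junk value `0` otherwise (same
normalisation as `plusPeriod` with `im` in place of `re`; beware that conventions for `Ω⁻` in the
literature differ by a factor `2`) (Cremona §2.8; Mazur–Tate–Teitelbaum §I.8). [folklore] -/
def minusPeriod : ℝ :=
  if h : ∃ Ω : ℝ, 0 < Ω ∧ imagPeriods f = AddSubgroup.zmultiples (Ω / 2) then h.choose else 0

/-- The **normalised plus symbol** `[r]⁺_f = re (plusSymbol f r) / Ω⁺_f ∈ ℝ` of
Mazur–Tate–Teitelbaum §I.8; `[0]⁺ = L(f, 1)/Ω⁺_f`. Rational for rational newforms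
(`IsNewform0.exists_rat_mul_plusPeriod`); junk `0` when `Ω⁺_f = 0` (division by zero). [folklore] -/
def normalizedPlusSymbol (r : ℚ) : ℝ :=
  (plusSymbol f r).re / plusPeriod f

/-- The **normalised minus symbol** `[r]⁻_f = im (minusSymbol f r) / Ω⁻_f ∈ ℝ` of
Mazur–Tate–Teitelbaum §I.8; junk `0` when `Ω⁻_f = 0`. [folklore] -/
def normalizedMinusSymbol (r : ℚ) : ℝ :=
  (minusSymbol f r).im / minusPeriod f

/-- The **twisted symbol sum** `∑_{a mod m} χ(a) {∞, a/m}_f` attached to a Dirichlet character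
`χ` mod `m`; for primitive `χ`, `τ(χ) L(f, χ⁻¹, 1) = ∑_{a mod m} χ(a) {∞, a/m}_f` (Birch's
formula, `twisted_LValue_eq`) (Mazur–Tate–Teitelbaum §I.8, (8.6); Cremona §2.8). The summand uses
the representative `a.val ∈ [0, m)`; any representative gives the same value since
`{∞, r + 1}_f = {∞, r}_f`. [folklore] -/
def twistedSymbolSum {m : ℕ} [NeZero m] (χ : DirichletCharacter ℂ m) : ℂ :=
  ∑ a : ZMod m, χ a * modularSymbol f ((a.val : ℚ) / m)

end Symbols

/-! ### Convergence, `L(f, 1)`, translation and conjugation -/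

section Basic

variable {N : ℕ} [NeZero N] (f : CuspForm (Gamma0 N) 2)

/-- The integrand `t ↦ f(r + it)` of `{∞, r}_f` is integrable on `(0, ∞)`: exponential decay as
`t → ∞` (`f` is cuspidal at `∞`) and as `t → 0⁺` (`f` is cuspidal at the cusp `r`, and
`|cz + d|⁻² = c⁻²t⁻²` along the ray for `γ = (a b; c d) ∈ SL(2, ℤ)` with `γ r = ∞`)
(Manin 1972, §1.5; Cremona §2.10). [cite: Manin1972, §1.5] -/
def integrableOn_modularSymbol_integrand : Prop :=
  ∀ (r : ℚ),
    IntegrableOn (fun t : ℝ ↦ f (ofComplex ((r : ℂ) + t * Complex.I))) (Set.Ioi 0)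

/-- The integrand `t ↦ f(τ + it)` of the Eichler integral is integrable on `(0, ∞)` (exponential
decay at `∞`, continuity at `0`) (Cremona §2.10). [cite: CremonaAlgorithms1997, §2.10] -/
def integrableOn_eichlerIntegral_integrand : Prop :=
  ∀ (τ : ℍ),
    IntegrableOn (fun t : ℝ ↦ f (ofComplex ((τ : ℂ) + t * Complex.I))) (Set.Ioi 0)

/-- `{∞, r + n}_f = {∞, r}_f` for `n ∈ ℤ`, since `f(z + 1) = f(z)` (`T ∈ Γ₀(N)`)
(Manin 1972, §1.2; Cremona §2.1). [cite: Manin1972, §1.2] -/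
def modularSymbol_add_intCast : Prop :=
  ∀ (r : ℚ) (n : ℤ),
    modularSymbol f (r + n) = modularSymbol f r

/-- **`{∞, 0}_f = L(f, 1)`**: for every entire continuation `L` of `L(f, s) = ∑ aₙ n⁻ˢ` (which
converges absolutely only for `re s > 2` in weight `2`, whence the continuation; such an `L`
exists and is unique, `exists_differentiable_eq_cuspFormLSeries`),
`2π ∫₀^∞ f(it) dt = ∑ aₙ ∫₀^∞ 2π e^{-2πnt} dt = ∑ aₙ/n = L(1)` (Manin 1972, Thm. 1.3 proof;
Cremona §2.8, (2.8.3); Mazur–Tate–Teitelbaum §I.8). [cite: Manin1972, Thm. 1.3 proof] -/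
def modularSymbol_zero_eq : Prop :=
  ∀ {L : ℂ → ℂ} (hL : Differentiable ℂ L) (hL' : ∀ s : ℂ, 2 < s.re → L s = cuspFormLSeries f s),
    modularSymbol f 0 = L 1

-- Binder repair (2026-08-16): the header instance deliberately shadows the section's, which a
-- `def` does not capture (it ranged too widely before); the overlapping-instances linter is moot.
set_option linter.overlappingInstances false in
/-- `{∞, 0}_f = L(f, 1) = 2π N^{-1/2} Λ_N(f, 1)` in terms of the entire continuation `Λ` of the
completed `L`-function `Λ_N(f, s) = N^{s/2} (2π)^{-s} Γ(s) L(f, s)` of item C7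
(Cremona §2.8; Diamond–Shurman §5.10). [cite: CremonaAlgorithms1997, §2.8]
(Binder repair 2026-08-16: `[NeZero N]` is written in the header so that it is a parameter of the
elaborated constant; as a section instance unused by the body it was silently dropped, so the fact
ranged over cases the printed theorem excludes.) -/
def modularSymbol_zero_eq_of_mem_completedCuspFormLContinuations [NeZero N] : Prop :=
  ∀ {Λ : ℂ → ℂ} (hΛ : Λ ∈ completedCuspFormLContinuations N f),
    modularSymbol f 0 = 2 * Real.pi / (N : ℂ) ^ (1 / 2 : ℂ) * Λ 1

/-- If all Fourier coefficients of `f` are real then `f(-z̄) = conj f(z)`, hence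
`{∞, -r}_f = conj {∞, r}_f` (Cremona §2.1.4, §2.8; Manin 1972, §1.6). [cite: Manin1972, §1.6] -/
def modularSymbol_neg_eq_conj : Prop :=
  ∀ (h : ∀ n, (cuspCoeff f n).im = 0) (r : ℚ),
    modularSymbol f (-r) = starRingEnd ℂ (modularSymbol f r)

/-- For `f` with real coefficients, `plusSymbol f r = re {∞, r}_f` (Cremona §2.8).
[cite: CremonaAlgorithms1997, §2.8] -/
def plusSymbol_eq_re : Prop :=
  ∀ (h : ∀ n, (cuspCoeff f n).im = 0) (r : ℚ),
    plusSymbol f r = ((modularSymbol f r).re : ℂ)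

omit [NeZero N] in
/-- `plusSymbol_eq_re` follows from the named fact `modularSymbol_neg_eq_conj`.
[cite: CremonaAlgorithms1997, §2.8] -/
theorem plusSymbol_eq_re_of (H : modularSymbol_neg_eq_conj f) : plusSymbol_eq_re f := by
  intro h r
  rw [plusSymbol, H h, Complex.add_conj]
  push_cast
  ring

/-- For `f` with real coefficients, `minusSymbol f r = i · im {∞, r}_f` (Cremona §2.8).
[cite: CremonaAlgorithms1997, §2.8] -/
def minusSymbol_eq_im_mul_I : Prop :=
  ∀ (h : ∀ n, (cuspCoeff f n).im = 0) (r : ℚ),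
    minusSymbol f r = ((modularSymbol f r).im : ℂ) * Complex.I

omit [NeZero N] in
/-- `minusSymbol_eq_im_mul_I` follows from the named fact `modularSymbol_neg_eq_conj`.
[cite: CremonaAlgorithms1997, §2.8] -/
theorem minusSymbol_eq_im_mul_I_of (H : modularSymbol_neg_eq_conj f) :
    minusSymbol_eq_im_mul_I f := by
  intro h r
  rw [minusSymbol, H h, Complex.sub_conj]
  push_cast
  ring

end Basic

/-! ### Manin's relations and the period lattice -/

section Manin

variable {N : ℕ} (f : CuspForm (Gamma0 N) 2)

/-- `{∞, 1∞}_f = 0` (the identity fixes `∞`). [folklore] -/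
@[simp] theorem cuspSymbol_one : cuspSymbol f 1 = 0 := by
  simp [cuspSymbol]

/-- Every `{∞, γ∞}_f` lies in the period lattice `Λ_f` (by definition). [folklore] -/
theorem cuspSymbol_mem_periodLattice (γ : Gamma0 N) : cuspSymbol f γ ∈ periodLattice f :=
  AddSubgroup.subset_closure ⟨γ, rfl⟩

variable [NeZero N]

-- Binder repair (2026-08-16): the header instance deliberately shadows the section's, which a
-- `def` does not capture (it ranged too widely before); the overlapping-instances linter is moot.
set_option linter.overlappingInstances false in
/-- **Manin**: `γ ↦ {∞, γ∞}_f` is a homomorphism `Γ₀(N) → ℂ`,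
`{∞, γδ∞} = {∞, γ∞} + {γ∞, γδ∞} = {∞, γ∞} + {∞, δ∞}` by `Γ₀(N)`-invariance of `f(z) dz`
(Manin 1972, Prop. 1.4 / Thm. 1.6; Cremona §2.1, (2.1.1)–(2.1.3)). [cite: Manin1972, Prop. 1.4 / Thm. 1.6]
(Binder repair 2026-08-16: `[NeZero N]` is written in the header so that it is a parameter of the
elaborated constant; as a section instance unused by the body it was silently dropped, so the fact
ranged over cases the printed theorem excludes.) -/
def cuspSymbol_mul [NeZero N] : Prop :=
  ∀ (γ δ : Gamma0 N),
    cuspSymbol f (γ * δ) = cuspSymbol f γ + cuspSymbol f δ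

/-- The **Eichler integral transforms by periods**:
`2πi ∫_{i∞}^{γτ} f - 2πi ∫_{i∞}^{τ} f = {τ, γτ}_f = {∞, γ∞}_f` for `γ ∈ Γ₀(N)`, `τ ∈ ℍ`
(decompose `τ → i∞ → γ i∞ → γτ` and use `∫_{γ∞}^{γτ} f = ∫_{∞}^{τ} f`); in particular
`{τ, γτ}` is independent of `τ` (Manin 1972, Prop. 1.4; Cremona §2.1, Prop. 2.1.1; Shimura
1971, §7.2). [cite: Manin1972, Prop. 1.4] -/
def eichlerIntegral_smul_sub : Prop :=
  ∀ (γ : Gamma0 N) (τ : ℍ),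
    eichlerIntegral f ((γ : SL(2, ℤ)) • τ) - eichlerIntegral f τ = cuspSymbol f γ

/-- The Eichler integral is `Γ₀(N)`-invariant modulo the period lattice:
`2πi ∫_{i∞}^{γτ} f - 2πi ∫_{i∞}^{τ} f ∈ Λ_f`, so `τ ↦ 2πi ∫_{i∞}^τ f` descends to the modular
parametrisation `X₀(N) → ℂ/Λ_f` (Manin 1972, Prop. 1.4; Cremona §2.10; Shimura 1971, Thm. 7.14). [cite: Manin1972, Prop. 1.4] -/
def eichlerIntegral_gamma_smul : Prop :=
  ∀ (γ : Gamma0 N) (τ : ℍ),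
    eichlerIntegral f ((γ : SL(2, ℤ)) • τ) - eichlerIntegral f τ ∈ periodLattice f

/- interim proof relied on results that are now named facts (D-0014); demoted to a fact by the D-0014 sorry-sweep, proof preserved:
:= by
  rw [eichlerIntegral_smul_sub]
  exact cuspSymbol_mem_periodLattice f γ
-/

/-- **Manin relation** `{∞, γr}_f = {∞, γ∞}_f + {γ∞, γr}_f = {∞, γ∞}_f + {∞, r}_f` for
`γ = (a b; c d) ∈ Γ₀(N)` and a rational cusp `r` with `γ r = (ar + b)/(cr + d) ≠ ∞`, i.e.
`cr + d ≠ 0` (Manin 1972, Prop. 1.4, Thm. 1.6; Cremona §2.1–2.2). [cite: Manin1972, Prop. 1.4  Thm. 1.6] -/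
def modularSymbol_gamma0_smul : Prop :=
  ∀ (γ : Gamma0 N) (r : ℚ) (hr : ((γ : SL(2, ℤ)) 1 0 : ℚ) * r + ((γ : SL(2, ℤ)) 1 1 : ℚ) ≠ 0),
    modularSymbol f
        ((((γ : SL(2, ℤ)) 0 0 : ℚ) * r + ((γ : SL(2, ℤ)) 0 1 : ℚ)) /
          (((γ : SL(2, ℤ)) 1 0 : ℚ) * r + ((γ : SL(2, ℤ)) 1 1 : ℚ))) =
      cuspSymbol f γ + modularSymbol f r

/-- **Manin–Drinfeld theorem** (general form): every modular symbol `{∞, r}_f` between cusps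
lies in `ℚ ⊗ Λ_f`, i.e. some positive integer multiple of it is a period over a closed path,
because the difference of two cusps is a torsion point of `J₀(N)` (Manin 1972, Cor. 3.6;
Drinfeld 1973, Thm. 1; Cremona §2.8). [cite: Manin1972, Cor. 3.6] -/
def exists_nsmul_modularSymbol_mem_periodLattice : Prop :=
  ∀ (r : ℚ),
    ∃ n : ℕ, 0 < n ∧ n • modularSymbol f r ∈ periodLattice f

end Manin

/-! ### Rational newforms: Eichler–Shimura lattice and rationality of `[r]^±` -/

section Newform

variable {N : ℕ} [NeZero N] {f : CuspForm (Gamma0 N) 2}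

/-- **Eichler–Shimura**: for a normalised newform `f ∈ S_2(Γ₀(N))` with rational coefficients,
the period lattice `Λ_f` is a lattice in `ℂ` (discrete of rank `2`, spanning `ℂ` over `ℝ`);
`ℂ/Λ_f` is the elliptic curve `E_f` attached to `f` (Shimura 1971, Thm. 7.14; Cremona §2.6–2.7;
Manin 1972, Thm. 1.9). [cite: Shimura1971, Thm. 7.14] -/
def isZLattice_periodLattice : Prop :=
  ∀ (hf : IsNewform0 f) (hQ : coeffField f = ⊥),
    ∃ _ : DiscreteTopology (AddSubgroup.toIntSubmodule (periodLattice f)),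
      IsZLattice ℝ (AddSubgroup.toIntSubmodule (periodLattice f))

/-- For a newform with rational (hence real) coefficients the period lattice is stable under
complex conjugation (`{∞, γ∞}‾ = {∞, γ'∞}` with `γ' = ε γ ε`, `ε = diag(-1, 1)`, which
normalises `Γ₀(N)`) (Cremona §2.6, §2.8; Manin 1972, §1.6). [cite: Manin1972, §1.6] -/
def conj_mem_periodLattice : Prop :=
  ∀ (hf : IsNewform0 f) (hQ : coeffField f = ⊥) {z : ℂ} (hz : z ∈ periodLattice f),
    starRingEnd ℂ z ∈ periodLattice f

/-- For a rational newform, `Ω⁺_f > 0`: `re Λ_f` is infinite cyclic since `Λ_f` is a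
conjugation-stable rank-`2` lattice (Cremona §2.8). [cite: CremonaAlgorithms1997, §2.8] -/
def IsNewform0.plusPeriod_pos : Prop :=
  ∀ (hf : IsNewform0 f) (hQ : coeffField f = ⊥),
    0 < plusPeriod f

/-- For a rational newform, `Ω⁻_f > 0` (Cremona §2.8). [cite: CremonaAlgorithms1997, §2.8] -/
def IsNewform0.minusPeriod_pos : Prop :=
  ∀ (hf : IsNewform0 f) (hQ : coeffField f = ⊥),
    0 < minusPeriod f

/-- **Manin–Drinfeld rationality of `[r]⁺`**: for a normalised newform `f ∈ S_2(Γ₀(N))` with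
rational coefficients, `Ω⁺_f ≠ 0` and `re (plusSymbol f r) ∈ ℚ · Ω⁺_f` for every rational `r`,
i.e. `[r]⁺_f ∈ ℚ`. Non-trivial because `Ω⁺_f` is built from closed paths `{∞, γ∞}` only, while
`{∞, r}` is not closed (Manin 1972, Cor. 3.6 with Thm. 1.9; Drinfeld 1973;
Mazur–Tate–Teitelbaum §I.8; Cremona §2.8). [cite: Manin1972, Cor. 3.6 with Thm. 1.9] -/
def IsNewform0.exists_rat_smul_plusPeriod : Prop :=
  ∀ (hf : IsNewform0 f) (hQ : coeffField f = ⊥),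
    plusPeriod f ≠ 0 ∧ ∀ r : ℚ, ∃ q : ℚ, (plusSymbol f r).re = q • plusPeriod f

/-- **Manin–Drinfeld rationality of `[r]⁻`**: for a rational newform, `Ω⁻_f ≠ 0` and
`im (minusSymbol f r) ∈ ℚ · Ω⁻_f` for every rational `r` (Manin 1972, Cor. 3.6; Drinfeld 1973;
Mazur–Tate–Teitelbaum §I.8; Cremona §2.8). [cite: Manin1972, Cor. 3.6] -/
def IsNewform0.exists_rat_smul_minusPeriod : Prop :=
  ∀ (hf : IsNewform0 f) (hQ : coeffField f = ⊥),
    minusPeriod f ≠ 0 ∧ ∀ r : ℚ, ∃ q : ℚ, (minusSymbol f r).im = q • minusPeriod f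

/-- For a rational newform, `[r]⁺_f ∈ ℚ` (Mazur–Tate–Teitelbaum §I.8).
[cite: MazurTateTeitelbaum1986Invent, §I.8] -/
def IsNewform0.exists_normalizedPlusSymbol_eq_ratCast : Prop :=
  ∀ (hf : IsNewform0 f) (hQ : coeffField f = ⊥) (r : ℚ),
    ∃ q : ℚ, normalizedPlusSymbol f r = q

/-- `[r]⁺_f ∈ ℚ` follows from the Manin–Drinfeld named fact `exists_rat_smul_plusPeriod`.
[cite: MazurTateTeitelbaum1986Invent, §I.8] -/
theorem IsNewform0.exists_normalizedPlusSymbol_eq_ratCast_of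
    (H : IsNewform0.exists_rat_smul_plusPeriod (f := f)) :
    IsNewform0.exists_normalizedPlusSymbol_eq_ratCast (f := f) := by
  intro hf hQ r
  obtain ⟨h0, h⟩ := H hf hQ
  obtain ⟨q, hq⟩ := h r
  exact ⟨q, by rw [normalizedPlusSymbol, hq, Rat.smul_def, mul_div_cancel_right₀ _ h0]⟩

/-- `[0]⁺_f = L(f, 1) / Ω⁺_f` for `f` with real coefficients, `L` the entire continuation of
`L(f, s)` (Mazur–Tate–Teitelbaum §I.8; Cremona §2.8, (2.8.10)).
[cite: MazurTateTeitelbaum1986Invent, §I.8 (8.6)] -/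
def normalizedPlusSymbol_zero : Prop :=
  ∀ (h : ∀ n, (cuspCoeff f n).im = 0) {L : ℂ → ℂ} (hL : Differentiable ℂ L) (hL' : ∀ s : ℂ, 2 < s.re → L s = cuspFormLSeries f s),
    normalizedPlusSymbol f 0 = (L 1).re / plusPeriod f

omit [NeZero N] in
/-- `[0]⁺_f = re L(f,1) / Ω⁺_f` follows from the named facts `plusSymbol_eq_re` and
`modularSymbol_zero_eq`. [cite: MazurTateTeitelbaum1986Invent, §I.8 (8.6)] -/
theorem normalizedPlusSymbol_zero_of (H₁ : plusSymbol_eq_re f) (H₂ : modularSymbol_zero_eq f) :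
    normalizedPlusSymbol_zero (f := f) := by
  intro h L hL hL'
  rw [normalizedPlusSymbol, H₁ h, Complex.ofReal_re, H₂ hL hL']

end Newform

/-! ### Twisted `L`-values (Birch's formula) -/

section Twist

variable {N : ℕ} [NeZero N] (f : CuspForm (Gamma0 N) 2) {m : ℕ} [NeZero m]

/-- The twisted `L`-series `L(f, χ, s) = ∑ χ(n) aₙ n⁻ˢ` (absolutely convergent for `re s > 2`)
has an entire continuation: `f_χ = ∑ χ(n) aₙ qⁿ` is a cusp form of weight `2` on `Γ₁(Nm²)`
(Shimura 1971, Prop. 3.64, Thm. 3.66). [cite: Shimura1971, Prop. 3.64  Thm. 3.66] -/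
def exists_differentiable_eq_twistedLSeries : Prop :=
  ∀ (χ : DirichletCharacter ℂ m),
    ∃ L : ℂ → ℂ, Differentiable ℂ L ∧ ∀ s : ℂ, 2 < s.re → L s = twistedLSeries f χ s

/-- **Birch's formula** (Birch 1971; Mazur–Tate–Teitelbaum §I.8, (8.6); Cremona §2.8): for a
*primitive* Dirichlet character `χ` mod `m` and the entire continuation `L` of `L(f, χ, s)`
(`exists_differentiable_eq_twistedLSeries`),
`τ(χ⁻¹) · L(f, χ, 1) = ∑_{a mod m} χ⁻¹(a) {∞, a/m}_f`,
where `τ(χ⁻¹) = ∑_a χ⁻¹(a) e^{2πia/m}` (Mathlib `gaussSum χ⁻¹ ZMod.stdAddChar`). Proof sketch: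
`∑_a χ⁻¹(a) f(z + a/m) = τ(χ⁻¹) f_χ(z)` (Mathlib `gaussSum_mulShift_of_isPrimitive`), then
integrate along `it`, `t ∈ (0, ∞)`, as in `modularSymbol_zero_eq`. Coprimality of `m` and `N`
is not needed for this identity. [cite: Birch1971] -/
def twisted_LValue_eq : Prop :=
  ∀ {χ : DirichletCharacter ℂ m} (hχ : χ.IsPrimitive) {L : ℂ → ℂ} (hL : Differentiable ℂ L) (hL' : ∀ s : ℂ, 2 < s.re → L s = twistedLSeries f χ s),
    gaussSum χ⁻¹ (ZMod.stdAddChar (N := m)) * L 1 = twistedSymbolSum f χ⁻¹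

end Twist

/-! ### The lattice step of `Ω^± > 0` (Cremona §2.8), proved -/

section PeriodLattice

/-- **Lattice lemma behind `Ω^±_f > 0`** (Cremona §2.8: "in each case `Ω(f)` is twice the
least real part of a period of `f`"). Let `L ⊆ ℂ` be an additive subgroup with `0` isolated
(`‖z‖ < ε, z ∈ L ⇒ z = 0`) and `φ : ℂ →+ ℝ` such that for every `z ∈ L` some `w ∈ L` has
`‖w‖ = 2|φ z|` (for a conjugation-stable `L`: `w = z + z̄` when `φ = re`, `w = z - z̄` when
`φ = im`). If `φ` does not vanish on `L`, then `φ(L) = ℤ · a` for a unique `a > 0`, the least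
positive element of `φ(L)`: `φ(L)` misses `(0, ε/2)`, hence is cyclic. [cite: CremonaAlgorithms1997, §2.8] -/
theorem exists_pos_map_eq_zmultiples_of_isolated_zero {L : AddSubgroup ℂ}
    (hd : ∃ ε : ℝ, 0 < ε ∧ ∀ z ∈ L, ‖z‖ < ε → z = 0) (φ : ℂ →+ ℝ)
    (hφ : ∀ z ∈ L, ∃ w ∈ L, ‖w‖ = 2 * |φ z|) (hne : ∃ z ∈ L, φ z ≠ 0) :
    ∃ a : ℝ, 0 < a ∧ L.map φ = AddSubgroup.zmultiples a := by
  obtain ⟨ε, hε, hd⟩ := hd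
  have hbot : L.map φ ≠ ⊥ := by
    obtain ⟨z, hz, hz0⟩ := hne
    intro h
    exact hz0 ((AddSubgroup.eq_bot_iff_forall _).mp h _ (AddSubgroup.mem_map_of_mem φ hz))
  have hdisj : Disjoint (L.map φ : Set ℝ) (Set.Ioo 0 (ε / 2)) := by
    rw [Set.disjoint_left]
    rintro x ⟨z, hz, rfl⟩ ⟨h0, hε2⟩
    obtain ⟨w, hw, hnorm⟩ := hφ z hz
    have hw0 : w = 0 := hd w hw (by rw [hnorm, abs_of_pos h0]; linarith)
    rw [hw0, norm_zero, abs_of_pos h0] at hnorm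
    linarith
  obtain ⟨a, ha⟩ := AddSubgroup.exists_isLeast_pos hbot (half_pos hε) hdisj
  exact ⟨a, ha.1.2, by rw [AddSubgroup.cyclic_of_min ha, AddSubgroup.zmultiples_eq_closure]⟩

/-- For a discrete, conjugation-stable additive subgroup `L ⊆ ℂ` spanning `ℂ` over `ℝ` (e.g. the
period lattice of a rational newform), `re L = ℤ · (Ω/2)` for some `Ω > 0`: `2 re z = z + z̄ ∈ L`,
so `re L` has `0` isolated and is cyclic, and `re` cannot vanish on a spanning set
(Cremona §2.8). [cite: CremonaAlgorithms1997, §2.8] -/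
theorem exists_pos_map_re_eq_zmultiples {L : AddSubgroup ℂ}
    [DiscreteTopology (AddSubgroup.toIntSubmodule L)]
    (hL : IsZLattice ℝ (AddSubgroup.toIntSubmodule L))
    (hconj : ∀ z ∈ L, starRingEnd ℂ z ∈ L) :
    ∃ Ω : ℝ, 0 < Ω ∧ L.map Complex.reLm.toAddMonoidHom = AddSubgroup.zmultiples (Ω / 2) := by
  have hd : ∃ ε : ℝ, 0 < ε ∧ ∀ z ∈ L, ‖z‖ < ε → z = 0 := by
    have ho : IsOpen ({0} : Set (AddSubgroup.toIntSubmodule L)) := isOpen_discrete _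
    obtain ⟨ε, hε, hε'⟩ := Metric.isOpen_singleton_iff.mp ho
    refine ⟨ε, hε, fun z hz hzε ↦ ?_⟩
    have := hε' ⟨z, hz⟩ (by simpa [Subtype.dist_eq] using hzε)
    exact congrArg Subtype.val this
  have hφ : ∀ z ∈ L, ∃ w ∈ L, ‖w‖ = 2 * |Complex.reLm.toAddMonoidHom z| := by
    intro z hz
    refine ⟨z + starRingEnd ℂ z, add_mem hz (hconj z hz), ?_⟩
    rw [Complex.add_conj]
    simp
  have hne : ∃ z ∈ L, Complex.reLm.toAddMonoidHom z ≠ 0 := by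
    by_contra! h
    have hle : Submodule.span ℝ (AddSubgroup.toIntSubmodule L : Set ℂ) ≤
        LinearMap.ker Complex.reLm := by
      rw [Submodule.span_le]
      intro z hz
      exact h z hz
    rw [hL.span_top] at hle
    simpa using hle (Submodule.mem_top (x := (1 : ℂ)))
  obtain ⟨a, ha, h⟩ := exists_pos_map_eq_zmultiples_of_isolated_zero hd _ hφ hne
  exact ⟨2 * a, by positivity, by rw [h, mul_div_cancel_left₀ _ two_ne_zero]⟩

/-- Same as `exists_pos_map_re_eq_zmultiples` for imaginary parts: `im L = ℤ · (Ω/2)` for some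
`Ω > 0`, using `2i im z = z - z̄ ∈ L` (Cremona §2.8, §2.10). [cite: CremonaAlgorithms1997, §2.8] -/
theorem exists_pos_map_im_eq_zmultiples {L : AddSubgroup ℂ}
    [DiscreteTopology (AddSubgroup.toIntSubmodule L)]
    (hL : IsZLattice ℝ (AddSubgroup.toIntSubmodule L))
    (hconj : ∀ z ∈ L, starRingEnd ℂ z ∈ L) :
    ∃ Ω : ℝ, 0 < Ω ∧ L.map Complex.imLm.toAddMonoidHom = AddSubgroup.zmultiples (Ω / 2) := by
  have hd : ∃ ε : ℝ, 0 < ε ∧ ∀ z ∈ L, ‖z‖ < ε → z = 0 := by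
    have ho : IsOpen ({0} : Set (AddSubgroup.toIntSubmodule L)) := isOpen_discrete _
    obtain ⟨ε, hε, hε'⟩ := Metric.isOpen_singleton_iff.mp ho
    refine ⟨ε, hε, fun z hz hzε ↦ ?_⟩
    have := hε' ⟨z, hz⟩ (by simpa [Subtype.dist_eq] using hzε)
    exact congrArg Subtype.val this
  have hφ : ∀ z ∈ L, ∃ w ∈ L, ‖w‖ = 2 * |Complex.imLm.toAddMonoidHom z| := by
    intro z hz
    refine ⟨z - starRingEnd ℂ z, sub_mem hz (hconj z hz), ?_⟩
    rw [Complex.sub_conj]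
    simp
  have hne : ∃ z ∈ L, Complex.imLm.toAddMonoidHom z ≠ 0 := by
    by_contra! h
    have hle : Submodule.span ℝ (AddSubgroup.toIntSubmodule L : Set ℂ) ≤
        LinearMap.ker Complex.imLm := by
      rw [Submodule.span_le]
      intro z hz
      exact h z hz
    rw [hL.span_top] at hle
    simpa using hle (Submodule.mem_top (x := Complex.I))
  obtain ⟨a, ha, h⟩ := exists_pos_map_eq_zmultiples_of_isolated_zero hd _ hφ hne
  exact ⟨2 * a, by positivity, by rw [h, mul_div_cancel_left₀ _ two_ne_zero]⟩

end PeriodLattice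

section NewformPeriods

variable {N : ℕ} [NeZero N] {f : CuspForm (Gamma0 N) 2}

/-- **`Ω⁺_f > 0` from Eichler–Shimura and conjugation-stability**: the named fact
`IsNewform0.plusPeriod_pos` follows from the named facts `isZLattice_periodLattice`
(Eichler–Shimura: `Λ_f` is a rank-`2` lattice, Cremona §2.6, citing Shimura) and
`conj_mem_periodLattice` (`Λ̄_f = Λ_f`), by `exists_pos_map_re_eq_zmultiples`
(Cremona §2.8: "`Ω(f)` is twice the least real part of a period of `f`"). [cite: CremonaAlgorithms1997, §2.8] -/
theorem IsNewform0.plusPeriod_pos_of (H₁ : isZLattice_periodLattice (f := f))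
    (H₂ : conj_mem_periodLattice (f := f)) : IsNewform0.plusPeriod_pos (f := f) := by
  intro hf hQ
  obtain ⟨_, hlat⟩ := H₁ hf hQ
  have h : ∃ Ω : ℝ, 0 < Ω ∧ realPeriods f = AddSubgroup.zmultiples (Ω / 2) :=
    exists_pos_map_re_eq_zmultiples hlat (fun _ hz ↦ H₂ hf hQ hz)
  simp only [plusPeriod, dif_pos h]
  exact h.choose_spec.1

/-- **`Ω⁻_f > 0` from Eichler–Shimura and conjugation-stability**: `IsNewform0.minusPeriod_pos`
follows from `isZLattice_periodLattice` and `conj_mem_periodLattice` by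
`exists_pos_map_im_eq_zmultiples` (Cremona §2.8, §2.10). [cite: CremonaAlgorithms1997, §2.8] -/
theorem IsNewform0.minusPeriod_pos_of (H₁ : isZLattice_periodLattice (f := f))
    (H₂ : conj_mem_periodLattice (f := f)) : IsNewform0.minusPeriod_pos (f := f) := by
  intro hf hQ
  obtain ⟨_, hlat⟩ := H₁ hf hQ
  have h : ∃ Ω : ℝ, 0 < Ω ∧ imagPeriods f = AddSubgroup.zmultiples (Ω / 2) :=
    exists_pos_map_im_eq_zmultiples hlat (fun _ hz ↦ H₂ hf hQ hz)
  simp only [minusPeriod, dif_pos h]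
  exact h.choose_spec.1

end NewformPeriods

end Literature.NumberTheory.EllipticCurves.ModularForms
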